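import Summits.CriticalPhenomena.PercolationContinuityZ3.Theorems.PercNearOneGluingNoHeavyLowerTailSuperTerminalP3LamGluing
import HarnessLib

/-!
# `P3_λ` for every `λ ≥ 3/2` — including the SHARP row `λ = 3/2` — only sees the PORT PART of a finite weighted graph

Support file for crux `stmt-CriticalPhenomena-4575` (`NoHeavyLowerTail`), seat `prim-l12-p1` gen 33 (`--supports stmt-CriticalPhenomena-4575`);
companion of `…SuperTerminalP3LamGluing` (THEOREM C′: for `λ ≥ 8/5` the row reduces to `{s,a,b,c}`-primes) and of
`…SuperTerminalPrimeReduction`.  No definitions, no sorries, standard axioms.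

THE ROW.  Bond percolation `μ = prodBernoulli w` on a finite vertex type `V`, pairwise distinct `s a b c`; `F = {s↔a} ∩ {s↮b}`,
`T = {s,a,b}`.  `P3_λ` is `μ(F)·μ(c ↔ T) ≤ λ·μ(F ∩ c ↔ T)` (`λ = 2` is the face row `P3½` of the super-terminal quartic law `V4`;
the conjectured sharp constant is `λ = 3/2`; at `s = a` and `λ = 3/2` it is the 3-point face inequality `(C½)` of
`ThreePointIsoSexticUniversal.faceHalf_all`).  The cell-level `∥`-stability behind THEOREM C′ holds exactly for `λ ≥ 8/5`
(`SuperTerminalP3LamStable.p3lam_stable_sharp`) and is FALSE for abstract laws at `λ = 3/2` (memos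
`FROM-prim-l12-p1-g31-P3-SHARP-ROW-STABILITY.md`, `FROM-prim-l12-p1-g32-P3SHARP-DOWNSET-ANALYSIS.md`).

MAIN THEOREM (`p3lam_of_portPieces`).  Let `part : V → ι` split `w` along `T₄ = {s,a,b,c}` (non-terminal pairs across labels have
weight `0`) and let `J` be a set of labels containing every piece ADJACENT TO THE PORT (every non-terminal `v` with `w(c,v) > 0` has
`part v ∈ J`).  **If `P3_λ`, `λ ≥ 3/2`, holds for the partial union `w_J := w·1_{terminal pairs ∪ pieces of J}`, it holds for `w`.**
So the pieces of `G ∖ {s,a,b,c}` that are not adjacent to the port `c` are irrelevant to every row `P3_λ` with `λ ≥ 3/2`; for the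
sharp row this is the part of the reduction to primes that survives the failure of cell-level stability (the pieces that DO touch the
port are exactly where the abstract two-piece counterexamples of gen 31/32 live).

PROOF.  In the down-set coordinates `d0..d7` of `…SuperTerminalDownsets` a piece in which the port has no positive pair has the
vector `(n, x, x, n, x, n, n, 1)` (`dvec_portIsolated`: the port is a.s. isolated, so every down-set only constrains `{s,a,b}`), and
gluing such a vector onto ANY vector `d` is LINEAR in the row:
`Row_λ(d·e) = n·Row_λ(d) + (x − n)·[(d2+d4−d1)(1−d7) − λ(d2+d4−2d1)]` (`dvec_p3lam_mul_portIsolated`), where the bracket is the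
face inequality `Face[d1,d2,d4,d7]` of the `sa`-glued graph (`≤ 0` for every WEIGHT by `SuperTerminalP3LamDvec.face_of_weight`, i.e. by
the sextic law `(Q6)`, as soon as `λ ≥ 3/2`).  The assembly is the induction of `SuperTerminalP3LamGluing.p3lam_of_pieces` over partial
unions (`SuperTerminalP3LamDvec.real_partLE_partialUnion`, [BeicheltTittmann2012, Thm. 7.5]), started at `J` instead of at the terminal piece.
-/

namespace Summit.CriticalPhenomena.PercolationContinuityZ3.Theorems.SuperTerminalP3LamPortPieces

open MeasureTheory Set Filter
open Literature.Probability.Percolation Literature.Probability.Percolation.PartitionGluing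
open Literature.Probability.LatticeModels (prodBernoulli)
open SuperTerminalDownsets SuperTerminalDownsetEvents SuperTerminalP3LamDvec SuperTerminalP3LamGluing
open scoped Classical

variable {V : Type*} [Fintype V]

/-- The ORDER RELATIONS of a down-set vector (as in `…SuperTerminalP3LamDvec`).  Local notation only. -/
local notation "Core[" x0 "," x1 "," x2 "," x3 "," x4 "," x5 "," x6 "," x7 "]" =>
  (((0 : ℝ) ≤ x0 ∧ x0 ≤ x1 ∧ x0 ≤ x3 ∧ x0 ≤ x5 ∧ x0 ≤ x6 ∧ (0 : ℝ) ≤ x7 ∧ x7 ≤ 1 ∧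
      (0 : ℝ) ≤ x2 - x3 - x1 + x0 ∧ (0 : ℝ) ≤ x4 - x5 - x6 + x0 - x1 + x0) : Prop)

/-- The row `P3_λ` in down-set coordinates: `μ(F)(1 − γ) ≤ λ·μ(F ∩ c↔T)` (as in `…SuperTerminalP3LamDvec`).  Local notation only. -/
local notation "RowLam[" lam ";" x0 "," x1 "," x2 "," x3 "," x4 "," x5 "," x6 "," x7 "]" =>
  (((x2 - x3 + x4 - x5 - x6 - x1 + 2 * x0) * (1 - x7) ≤ lam * (x2 - x3 + x4 - x5 - x6 - 2 * x1 + 3 * x0)) : Prop)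

/-- The face inequality `(C½)` of the `sa`-glued graph in down-set coordinates (as in `…SuperTerminalP3LamDvec`).  Local notation only. -/
local notation "Face[" x1 "," x2 "," x4 "," x7 "]" => ((2 * (x2 + x4 - x1) * (1 - x7) ≤ 3 * (x2 + x4 - 2 * x1)) : Prop)

/-! ## Cell algebra: gluing a port-isolated piece is linear in the row -/

/-- **Gluing a port-isolated piece.**  For `λ ≥ 3/2`: if `d` satisfies the order relations, the row `P3_λ` and the face inequality, and
`e = (e0, e1, e1, e0, e1, e0, e0, 1)` with `0 ≤ e0 ≤ e1` (the down-set vector of a piece in which the port has no positive pair), then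
the coordinatewise product satisfies `P3_λ`.  The identity behind it:
`Row_λ(d·e) = e0·Row_λ(d) + (e1 − e0)·[(d2+d4−d1)(1−d7) − λ(d2+d4−2d1)]`. [this work] -/
theorem dvec_p3lam_mul_portIsolated {lam d0 d1 d2 d3 d4 d5 d6 d7 e0 e1 e2 e3 e4 e5 e6 e7 : ℝ} (hlam : 3 / 2 ≤ lam)
    (hd : Core[d0, d1, d2, d3, d4, d5, d6, d7]) (hP : RowLam[lam; d0, d1, d2, d3, d4, d5, d6, d7]) (hF : Face[d1, d2, d4, d7])
    (h2 : e2 = e1) (h3 : e3 = e0) (h4 : e4 = e1) (h5 : e5 = e0) (h6 : e6 = e0) (h7 : e7 = 1)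
    (he0 : 0 ≤ e0) (he01 : e0 ≤ e1) :
    RowLam[lam; d0 * e0, d1 * e1, d2 * e2, d3 * e3, d4 * e4, d5 * e5, d6 * e6, d7 * e7] := by
  rw [h2, h3, h4, h5, h6, h7]
  obtain ⟨h0, h1, h3', h5', h6', -, -, hζ, hτ⟩ := hd
  have hpos : 0 ≤ d2 + d4 - 2 * d1 := by linarith
  have hleaf : (d2 + d4 - d1) * (1 - d7) ≤ lam * (d2 + d4 - 2 * d1) := by
    have h32 : 3 / 2 * (d2 + d4 - 2 * d1) ≤ lam * (d2 + d4 - 2 * d1) := mul_le_mul_of_nonneg_right hlam hpos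
    linarith
  have k1 := mul_le_mul_of_nonneg_left hP he0
  have k2 := mul_le_mul_of_nonneg_left hleaf (sub_nonneg.2 he01)
  have key : (d2 * e1 - d3 * e0 + d4 * e1 - d5 * e0 - d6 * e0 - d1 * e1 + 2 * (d0 * e0)) * (1 - d7 * 1) -
      lam * (d2 * e1 - d3 * e0 + d4 * e1 - d5 * e0 - d6 * e0 - 2 * (d1 * e1) + 3 * (d0 * e0)) =
      (e0 * ((d2 - d3 + d4 - d5 - d6 - d1 + 2 * d0) * (1 - d7)) - e0 * (lam * (d2 - d3 + d4 - d5 - d6 - 2 * d1 + 3 * d0))) +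
      ((e1 - e0) * ((d2 + d4 - d1) * (1 - d7)) - (e1 - e0) * (lam * (d2 + d4 - 2 * d1))) := by ring
  have : (d2 * e1 - d3 * e0 + d4 * e1 - d5 * e0 - d6 * e0 - d1 * e1 + 2 * (d0 * e0)) * (1 - d7 * 1) -
      lam * (d2 * e1 - d3 * e0 + d4 * e1 - d5 * e0 - d6 * e0 - 2 * (d1 * e1) + 3 * (d0 * e0)) ≤ 0 := by
    rw [key]; linarith
  linarith

/-! ## The down-set vector of a piece in which the port has no positive pair -/

section Isolated
variable {s a b c : V}

/-- If every pair at `c` has weight `0`, then `μ(c ↔ v) = 0` for every `v ≠ c` (the null event "some pair at `c` is open" contains it: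
the first step of an open walk from `c` is a pair at `c`). [folklore] -/
theorem real_openConn_eq_zero_of_portIsolated (u : Sym2 V → unitInterval) (hc : ∀ x : V, x ≠ c → (u s(c, x) : ℝ) = 0)
    {v : V} (hv : v ≠ c) : (prodBernoulli u).real (openConn c v) = 0 := by
  classical
  set Z : Finset (Sym2 V) := Finset.univ.filter fun e' => ∃ x : V, x ≠ c ∧ e' = s(c, x) with hZ
  have hN : (prodBernoulli u).real {ω : BondConfig V | ∃ e' ∈ Z, e' ∈ ω} = 0 := by
    refine le_antisymm ((Literature.Probability.LatticeModels.prodBernoulli_real_exists_mem_le_sum u Z).trans (le_of_eq ?_))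
      measureReal_nonneg
    refine Finset.sum_eq_zero fun e' he' => ?_
    rw [hZ, Finset.mem_filter] at he'
    obtain ⟨x, hx, rfl⟩ := he'.2
    exact hc x hx
  have hsub : (openConn c v : Set (BondConfig V)) ⊆ {ω : BondConfig V | ∃ e' ∈ Z, e' ∈ ω} := by
    intro ω hω
    simp only [openConn, mem_setOf_eq] at hω
    obtain ⟨p⟩ := hω
    cases p with
    | nil => exact (hv rfl).elim
    | cons hadj rest =>
      rename_i q
      rw [openGraph_adj] at hadj
      refine ⟨s(c, q), ?_, hadj.1⟩
      rw [hZ, Finset.mem_filter]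
      exact ⟨Finset.mem_univ _, q, fun h => hadj.2 h.symm, rfl⟩
  exact le_antisymm ((measureReal_mono hsub).trans hN.le) measureReal_nonneg

/-- **The down-set vector of a port-isolated weight.**  If every pair at the port `c` has weight `0`, then in the coordinates
`d0..d7 = D(s|a|b|c), D(sa|b|c), D(sa|bc), D(s|a|bc), D(sac|b), D(sc|a|b), D(ac|s|b), D(c|sab)`:
`d2 = d1`, `d3 = d0`, `d4 = d1`, `d5 = d0`, `d6 = d0`, `d7 = 1` (the port is a.s. a singleton block). [this work] -/
theorem dvec_portIsolated (u : Sym2 V → unitInterval) (hd : s ≠ a ∧ s ≠ b ∧ s ≠ c ∧ a ≠ b ∧ a ≠ c ∧ b ≠ c)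
    (hc : ∀ x : V, x ≠ c → (u s(c, x) : ℝ) = 0) :
    (prodBernoulli u).real ((openConn s b)ᶜ ∩ (openConn s c)ᶜ ∩ (openConn a b)ᶜ ∩ (openConn a c)ᶜ : Set (BondConfig V)) =
        (prodBernoulli u).real ((openConn s b)ᶜ ∩ (openConn s c)ᶜ ∩ (openConn a b)ᶜ ∩ (openConn a c)ᶜ ∩ (openConn b c)ᶜ) ∧
      (prodBernoulli u).real ((openConn s a)ᶜ ∩ (openConn s b)ᶜ ∩ (openConn s c)ᶜ ∩ (openConn a b)ᶜ ∩ (openConn a c)ᶜ : Set (BondConfig V)) =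
        (prodBernoulli u).real
          ((openConn s a)ᶜ ∩ (openConn s b)ᶜ ∩ (openConn s c)ᶜ ∩ (openConn a b)ᶜ ∩ (openConn a c)ᶜ ∩ (openConn b c)ᶜ) ∧
      (prodBernoulli u).real ((openConn s b)ᶜ ∩ (openConn a b)ᶜ ∩ (openConn b c)ᶜ : Set (BondConfig V)) =
        (prodBernoulli u).real ((openConn s b)ᶜ ∩ (openConn s c)ᶜ ∩ (openConn a b)ᶜ ∩ (openConn a c)ᶜ ∩ (openConn b c)ᶜ) ∧
      (prodBernoulli u).real ((openConn s a)ᶜ ∩ (openConn s b)ᶜ ∩ (openConn a b)ᶜ ∩ (openConn a c)ᶜ ∩ (openConn b c)ᶜ : Set (BondConfig V)) =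
        (prodBernoulli u).real
          ((openConn s a)ᶜ ∩ (openConn s b)ᶜ ∩ (openConn s c)ᶜ ∩ (openConn a b)ᶜ ∩ (openConn a c)ᶜ ∩ (openConn b c)ᶜ) ∧
      (prodBernoulli u).real ((openConn s a)ᶜ ∩ (openConn s b)ᶜ ∩ (openConn s c)ᶜ ∩ (openConn a b)ᶜ ∩ (openConn b c)ᶜ : Set (BondConfig V)) =
        (prodBernoulli u).real
          ((openConn s a)ᶜ ∩ (openConn s b)ᶜ ∩ (openConn s c)ᶜ ∩ (openConn a b)ᶜ ∩ (openConn a c)ᶜ ∩ (openConn b c)ᶜ) ∧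
      (prodBernoulli u).real ((openConn c s)ᶜ ∩ (openConn c a)ᶜ ∩ (openConn c b)ᶜ : Set (BondConfig V)) = 1 := by
  -- the port is a.s. isolated
  have z : ∀ {v : V}, v ≠ c → ∀ᵐ ω ∂(prodBernoulli u), ω ∉ (openConn c v : Set (BondConfig V)) := fun hv =>
    measure_eq_zero_iff_ae_notMem.1
      ((measureReal_eq_zero_iff (by finiteness)).1 (real_openConn_eq_zero_of_portIsolated u hc hv))
  have hae : ∀ᵐ ω ∂(prodBernoulli u),
      ¬ (openGraph ω).Reachable c s ∧ ¬ (openGraph ω).Reachable c a ∧ ¬ (openGraph ω).Reachable c b := by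
    filter_upwards [z hd.2.2.1, z hd.2.2.2.2.1, z hd.2.2.2.2.2] with ω h1 h2 h3
    simp only [openConn, mem_setOf_eq] at h1 h2 h3
    exact ⟨h1, h2, h3⟩
  -- the two `{s,a,b}`-down-sets everything reduces to
  set X : Set (BondConfig V) := (openConn s b)ᶜ ∩ (openConn a b)ᶜ with hX
  set N : Set (BondConfig V) := (openConn s a)ᶜ ∩ (openConn s b)ᶜ ∩ (openConn a b)ᶜ with hN
  have E1 : (prodBernoulli u).real ((openConn s b)ᶜ ∩ (openConn s c)ᶜ ∩ (openConn a b)ᶜ ∩ (openConn a c)ᶜ ∩ (openConn b c)ᶜ) =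
      (prodBernoulli u).real X := by
    refine measureReal_congr (Filter.eventuallyEq_set.2 ?_)
    filter_upwards [hae] with ω hω
    have hsc : ¬ (openGraph ω).Reachable s c := fun h => hω.1 h.symm
    have hac : ¬ (openGraph ω).Reachable a c := fun h => hω.2.1 h.symm
    have hbc : ¬ (openGraph ω).Reachable b c := fun h => hω.2.2 h.symm
    simp only [hX, mem_inter_iff, mem_compl_iff, openConn, mem_setOf_eq]
    tauto
  have E2 : (prodBernoulli u).real ((openConn s b)ᶜ ∩ (openConn s c)ᶜ ∩ (openConn a b)ᶜ ∩ (openConn a c)ᶜ) =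
      (prodBernoulli u).real X := by
    refine measureReal_congr (Filter.eventuallyEq_set.2 ?_)
    filter_upwards [hae] with ω hω
    have hsc : ¬ (openGraph ω).Reachable s c := fun h => hω.1 h.symm
    have hac : ¬ (openGraph ω).Reachable a c := fun h => hω.2.1 h.symm
    simp only [hX, mem_inter_iff, mem_compl_iff, openConn, mem_setOf_eq]
    tauto
  have E4 : (prodBernoulli u).real ((openConn s b)ᶜ ∩ (openConn a b)ᶜ ∩ (openConn b c)ᶜ) = (prodBernoulli u).real X := by
    refine measureReal_congr (Filter.eventuallyEq_set.2 ?_)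
    filter_upwards [hae] with ω hω
    have hbc : ¬ (openGraph ω).Reachable b c := fun h => hω.2.2 h.symm
    simp only [hX, mem_inter_iff, mem_compl_iff, openConn, mem_setOf_eq]
    tauto
  have E0 : (prodBernoulli u).real
      ((openConn s a)ᶜ ∩ (openConn s b)ᶜ ∩ (openConn s c)ᶜ ∩ (openConn a b)ᶜ ∩ (openConn a c)ᶜ ∩ (openConn b c)ᶜ) =
      (prodBernoulli u).real N := by
    refine measureReal_congr (Filter.eventuallyEq_set.2 ?_)
    filter_upwards [hae] with ω hω
    have hsc : ¬ (openGraph ω).Reachable s c := fun h => hω.1 h.symm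
    have hac : ¬ (openGraph ω).Reachable a c := fun h => hω.2.1 h.symm
    have hbc : ¬ (openGraph ω).Reachable b c := fun h => hω.2.2 h.symm
    simp only [hN, mem_inter_iff, mem_compl_iff, openConn, mem_setOf_eq]
    tauto
  have E3 : (prodBernoulli u).real ((openConn s a)ᶜ ∩ (openConn s b)ᶜ ∩ (openConn s c)ᶜ ∩ (openConn a b)ᶜ ∩ (openConn a c)ᶜ) =
      (prodBernoulli u).real N := by
    refine measureReal_congr (Filter.eventuallyEq_set.2 ?_)
    filter_upwards [hae] with ω hω
    have hsc : ¬ (openGraph ω).Reachable s c := fun h => hω.1 h.symm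
    have hac : ¬ (openGraph ω).Reachable a c := fun h => hω.2.1 h.symm
    simp only [hN, mem_inter_iff, mem_compl_iff, openConn, mem_setOf_eq]
    tauto
  have E5 : (prodBernoulli u).real ((openConn s a)ᶜ ∩ (openConn s b)ᶜ ∩ (openConn a b)ᶜ ∩ (openConn a c)ᶜ ∩ (openConn b c)ᶜ) =
      (prodBernoulli u).real N := by
    refine measureReal_congr (Filter.eventuallyEq_set.2 ?_)
    filter_upwards [hae] with ω hω
    have hac : ¬ (openGraph ω).Reachable a c := fun h => hω.2.1 h.symm
    have hbc : ¬ (openGraph ω).Reachable b c := fun h => hω.2.2 h.symm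
    simp only [hN, mem_inter_iff, mem_compl_iff, openConn, mem_setOf_eq]
    tauto
  have E6 : (prodBernoulli u).real ((openConn s a)ᶜ ∩ (openConn s b)ᶜ ∩ (openConn s c)ᶜ ∩ (openConn a b)ᶜ ∩ (openConn b c)ᶜ) =
      (prodBernoulli u).real N := by
    refine measureReal_congr (Filter.eventuallyEq_set.2 ?_)
    filter_upwards [hae] with ω hω
    have hsc : ¬ (openGraph ω).Reachable s c := fun h => hω.1 h.symm
    have hbc : ¬ (openGraph ω).Reachable b c := fun h => hω.2.2 h.symm
    simp only [hN, mem_inter_iff, mem_compl_iff, openConn, mem_setOf_eq]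
    tauto
  have E7 : (prodBernoulli u).real ((openConn c s)ᶜ ∩ (openConn c a)ᶜ ∩ (openConn c b)ᶜ : Set (BondConfig V)) = 1 := by
    rw [← probReal_univ (μ := prodBernoulli u)]
    refine measureReal_congr (Filter.eventuallyEq_set.2 ?_)
    filter_upwards [hae] with ω hω
    simp only [mem_inter_iff, mem_compl_iff, openConn, mem_setOf_eq, mem_univ, iff_true]
    exact ⟨⟨hω.1, hω.2.1⟩, hω.2.2⟩
  exact ⟨E2.trans E1.symm, E3.trans E0.symm, E4.trans E1.symm, E5.trans E0.symm, E6.trans E0.symm, E7⟩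

end Isolated

/-! ## The assembly -/

section Pieces
variable {s a b c : V}

/-- **MAIN THEOREM: for `λ ≥ 3/2` the row `P3_λ` only sees the port part.**  Let `s a b c` be pairwise distinct, `part : V → ι` a
splitting of `w` along `{s,a,b,c}` (non-terminal pairs across labels have weight `0`), and `J` a set of labels such that every
non-terminal `v` with `w(c,v) ≠ 0` has `part v ∈ J` (the pieces outside `J` are not adjacent to the port).  If the partial union
`w_J := w·1_{terminal pairs ∪ pieces of J}` satisfies `μ(F)·μ(c ↔ T) ≤ λ·μ(F ∩ c ↔ T)` (`F = {s↔a}∩{s↮b}`, `T = {s,a,b}`), then so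
does `w`.  In particular, for the sharp row `λ = 3/2` a counterexample with the fewest internal vertices has every piece of
`G ∖ {s,a,b,c}` adjacent to the port. [this work] -/
theorem p3lam_of_portPieces {ι : Type*} [Fintype ι] {lam : ℝ} (hlam : 3 / 2 ≤ lam) (w : Sym2 V → unitInterval)
    (hd : s ≠ a ∧ s ≠ b ∧ s ≠ c ∧ a ≠ b ∧ a ≠ c ∧ b ≠ c) (part : V → ι)
    (hw : ∀ x y : V, x ∉ ({s, a, b, c} : Finset V) → y ∉ ({s, a, b, c} : Finset V) → part x ≠ part y → (w s(x, y) : ℝ) = 0)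
    (J : Finset ι) (hJ : ∀ v : V, v ∉ ({s, a, b, c} : Finset V) → part v ∉ J → (w s(c, v) : ℝ) = 0)
    (hrow :
      (prodBernoulli fun e => if e ∈ ({s, a, b, c} : Finset V).sym2 ∨ ∃ i ∈ J, e ∈ piecePairs {s, a, b, c} part i then w e else 0).real
          (openConn s a ∩ (openConn s b)ᶜ : Set (BondConfig V)) *
        (prodBernoulli fun e => if e ∈ ({s, a, b, c} : Finset V).sym2 ∨ ∃ i ∈ J, e ∈ piecePairs {s, a, b, c} part i then w e else 0).real
          ((openConn c s)ᶜ ∩ (openConn c a)ᶜ ∩ (openConn c b)ᶜ : Set (BondConfig V))ᶜ ≤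
      lam * (prodBernoulli fun e => if e ∈ ({s, a, b, c} : Finset V).sym2 ∨ ∃ i ∈ J, e ∈ piecePairs {s, a, b, c} part i
          then w e else 0).real
          (openConn s a ∩ (openConn s b)ᶜ ∩ ((openConn c s)ᶜ ∩ (openConn c a)ᶜ ∩ (openConn c b)ᶜ)ᶜ : Set (BondConfig V))) :
    (prodBernoulli w).real (openConn s a ∩ (openConn s b)ᶜ : Set (BondConfig V)) *
        (prodBernoulli w).real ((openConn c s)ᶜ ∩ (openConn c a)ᶜ ∩ (openConn c b)ᶜ : Set (BondConfig V))ᶜ ≤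
      lam * (prodBernoulli w).real (openConn s a ∩ (openConn s b)ᶜ ∩ ((openConn c s)ᶜ ∩ (openConn c a)ᶜ ∩ (openConn c b)ᶜ)ᶜ : Set (BondConfig V)) := by
  -- abbreviations: the terminal piece and the pieces
  set w₀ : Sym2 V → unitInterval := fun e => if e ∈ ({s, a, b, c} : Finset V).sym2 then w e else 0 with hw₀
  set wp : ι → Sym2 V → unitInterval := fun i e => if e ∈ piecePairs {s, a, b, c} part i then w e else 0 with hwp
  -- a piece outside `J` has no positive pair at the port
  have hcJ : ∀ i, i ∉ J → ∀ x : V, x ≠ c → ((wp i) s(c, x) : ℝ) = 0 := by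
    intro i hi x hx
    by_cases hmem : s(c, x) ∈ piecePairs ({s, a, b, c} : Finset V) part i
    · obtain ⟨u, v, ⟨hu, hui⟩, -, -, he⟩ := mem_piecePairs.1 hmem
      have hcT : c ∈ ({s, a, b, c} : Finset V) := by simp
      rcases Sym2.eq_iff.1 he with ⟨h1, -⟩ | ⟨-, h2⟩
      · exact absurd (h1 ▸ hcT) hu
      · have hxT : x ∉ ({s, a, b, c} : Finset V) := h2 ▸ hu
        have hpx : part x ∉ J := by rw [h2, hui]; exact hi
        have h0 := hJ x hxT hpx
        simp only [hwp, if_pos hmem]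
        exact h0
    · simp only [hwp, if_neg hmem]
      rfl
  have Cp := fun i => core_of_weight (wp i) s a b c
  -- induction over sets `S` of pieces outside `J`: the vector `D(w₀)·∏_{i ∈ J ∪ S} D(wᵢ)` (= `D(w_{J ∪ S})`) satisfies the row
  have key : ∀ S : Finset ι, (∀ i ∈ S, i ∉ J) →
      RowLam[lam;
        (prodBernoulli w₀).real ((openConn s a)ᶜ ∩ (openConn s b)ᶜ ∩ (openConn s c)ᶜ ∩ (openConn a b)ᶜ ∩ (openConn a c)ᶜ ∩ (openConn b c)ᶜ) *
          ∏ i ∈ J ∪ S, (prodBernoulli (wp i)).real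
            ((openConn s a)ᶜ ∩ (openConn s b)ᶜ ∩ (openConn s c)ᶜ ∩ (openConn a b)ᶜ ∩ (openConn a c)ᶜ ∩ (openConn b c)ᶜ),
        (prodBernoulli w₀).real ((openConn s b)ᶜ ∩ (openConn s c)ᶜ ∩ (openConn a b)ᶜ ∩ (openConn a c)ᶜ ∩ (openConn b c)ᶜ) *
          ∏ i ∈ J ∪ S, (prodBernoulli (wp i)).real ((openConn s b)ᶜ ∩ (openConn s c)ᶜ ∩ (openConn a b)ᶜ ∩ (openConn a c)ᶜ ∩ (openConn b c)ᶜ),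
        (prodBernoulli w₀).real ((openConn s b)ᶜ ∩ (openConn s c)ᶜ ∩ (openConn a b)ᶜ ∩ (openConn a c)ᶜ) *
          ∏ i ∈ J ∪ S, (prodBernoulli (wp i)).real ((openConn s b)ᶜ ∩ (openConn s c)ᶜ ∩ (openConn a b)ᶜ ∩ (openConn a c)ᶜ),
        (prodBernoulli w₀).real ((openConn s a)ᶜ ∩ (openConn s b)ᶜ ∩ (openConn s c)ᶜ ∩ (openConn a b)ᶜ ∩ (openConn a c)ᶜ) *
          ∏ i ∈ J ∪ S, (prodBernoulli (wp i)).real ((openConn s a)ᶜ ∩ (openConn s b)ᶜ ∩ (openConn s c)ᶜ ∩ (openConn a b)ᶜ ∩ (openConn a c)ᶜ),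
        (prodBernoulli w₀).real ((openConn s b)ᶜ ∩ (openConn a b)ᶜ ∩ (openConn b c)ᶜ) *
          ∏ i ∈ J ∪ S, (prodBernoulli (wp i)).real ((openConn s b)ᶜ ∩ (openConn a b)ᶜ ∩ (openConn b c)ᶜ),
        (prodBernoulli w₀).real ((openConn s a)ᶜ ∩ (openConn s b)ᶜ ∩ (openConn a b)ᶜ ∩ (openConn a c)ᶜ ∩ (openConn b c)ᶜ) *
          ∏ i ∈ J ∪ S, (prodBernoulli (wp i)).real ((openConn s a)ᶜ ∩ (openConn s b)ᶜ ∩ (openConn a b)ᶜ ∩ (openConn a c)ᶜ ∩ (openConn b c)ᶜ),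
        (prodBernoulli w₀).real ((openConn s a)ᶜ ∩ (openConn s b)ᶜ ∩ (openConn s c)ᶜ ∩ (openConn a b)ᶜ ∩ (openConn b c)ᶜ) *
          ∏ i ∈ J ∪ S, (prodBernoulli (wp i)).real ((openConn s a)ᶜ ∩ (openConn s b)ᶜ ∩ (openConn s c)ᶜ ∩ (openConn a b)ᶜ ∩ (openConn b c)ᶜ),
        (prodBernoulli w₀).real ((openConn c s)ᶜ ∩ (openConn c a)ᶜ ∩ (openConn c b)ᶜ) *
          ∏ i ∈ J ∪ S, (prodBernoulli (wp i)).real ((openConn c s)ᶜ ∩ (openConn c a)ᶜ ∩ (openConn c b)ᶜ)] := by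
    intro S
    induction S using Finset.induction_on with
    | empty =>
      intro _
      -- the hypothesis on `w_J`, in down-set coordinates, split along `J`
      have GJ := (rowLam_iff (fun e => if e ∈ ({s, a, b, c} : Finset V).sym2 ∨ ∃ i ∈ J, e ∈ piecePairs {s, a, b, c} part i
        then w e else 0) lam s a b c).1 hrow
      have pu := fun blk : V → ℕ => real_partLE_partialUnion w ({s, a, b, c} : Finset V) part hw J blk
      rw [← partLE_blk0 hd, ← partLE_blk1 hd, ← partLE_blk2 hd, ← partLE_blk3 hd, ← partLE_blk4 hd, ← partLE_blk5 hd,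
        ← partLE_blk6 hd, ← partLE_blk7 hd] at GJ
      simp only [pu] at GJ
      rw [partLE_blk0 hd, partLE_blk1 hd, partLE_blk2 hd, partLE_blk3 hd, partLE_blk4 hd, partLE_blk5 hd, partLE_blk6 hd,
        partLE_blk7 hd] at GJ
      simpa only [Finset.union_empty] using GJ
    | @insert j S hj ih =>
      intro hS
      have hjJ : j ∉ J := hS j (Finset.mem_insert_self j S)
      have IH := ih fun i hi => hS i (Finset.mem_insert_of_mem hi)
      -- the partial union `w_{J ∪ S}` is a weighted graph: order relations and face inequality for `D(w₀)·∏_{i∈J∪S} D(wᵢ)`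
      have pu := fun blk : V → ℕ => real_partLE_partialUnion w ({s, a, b, c} : Finset V) part hw (J ∪ S) blk
      have CS := core_of_weight (fun e => if e ∈ ({s, a, b, c} : Finset V).sym2 ∨ ∃ i ∈ J ∪ S, e ∈ piecePairs {s, a, b, c} part i
        then w e else 0) s a b c
      have FS := face_of_weight (fun e => if e ∈ ({s, a, b, c} : Finset V).sym2 ∨ ∃ i ∈ J ∪ S, e ∈ piecePairs {s, a, b, c} part i
        then w e else 0) hd
      rw [← partLE_blk0 hd, ← partLE_blk1 hd, ← partLE_blk2 hd, ← partLE_blk3 hd, ← partLE_blk4 hd, ← partLE_blk5 hd,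
        ← partLE_blk6 hd, ← partLE_blk7 hd] at CS
      rw [← partLE_blk1 hd, ← partLE_blk2 hd, ← partLE_blk4 hd, ← partLE_blk7 hd] at FS
      simp only [pu] at CS FS
      rw [partLE_blk0 hd, partLE_blk1 hd, partLE_blk2 hd, partLE_blk3 hd, partLE_blk4 hd, partLE_blk5 hd, partLE_blk6 hd,
        partLE_blk7 hd] at CS
      rw [partLE_blk1 hd, partLE_blk2 hd, partLE_blk4 hd, partLE_blk7 hd] at FS
      -- the new piece is port-isolated: its vector is `(e0, e1, e1, e0, e1, e0, e0, 1)`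
      obtain ⟨q2, q3, q4, q5, q6, q7⟩ := dvec_portIsolated (wp j) hd (hcJ j hjJ)
      obtain ⟨g0, g1, -, -, -, -, -, -, -⟩ := Cp j
      have step := dvec_p3lam_mul_portIsolated hlam CS IH FS q2 q3 q4 q5 q6 q7 g0 g1
      have hu : J ∪ insert j S = insert j (J ∪ S) := Finset.union_insert j J S
      have hj' : j ∉ J ∪ S := by
        rw [Finset.mem_union, not_or]; exact ⟨hjJ, hj⟩
      have r : ∀ (x : ℝ) (y : ι → ℝ), x * ∏ i ∈ J ∪ insert j S, y i = x * (∏ i ∈ J ∪ S, y i) * y j := fun x y => by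
        rw [hu, Finset.prod_insert hj']; ring
      simp only [r]
      exact step
  -- at `S = univ ∖ J` the vector is `D(w)` by the splitting formula
  set S : Finset ι := Finset.univ.filter fun i => i ∉ J with hSdef
  have hS : ∀ i ∈ S, i ∉ J := fun i hi => (Finset.mem_filter.1 hi).2
  have hJS : J ∪ S = Finset.univ := by
    ext i
    simp only [Finset.mem_union, Finset.mem_univ, iff_true, hSdef, Finset.mem_filter, true_and]
    exact em _
  have K := key S hS
  rw [hJS] at K
  have S0 := real_partLE_eq_terminalPiece_mul_prod w ({s, a, b, c} : Finset V) part
    (fun v => if v = a then 1 else if v = b then 2 else if v = c then 3 else (0 : ℕ)) hw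
  have S1 := real_partLE_eq_terminalPiece_mul_prod w ({s, a, b, c} : Finset V) part
    (fun v => if v = b then 1 else if v = c then 2 else (0 : ℕ)) hw
  have S2 := real_partLE_eq_terminalPiece_mul_prod w ({s, a, b, c} : Finset V) part
    (fun v => if v = b ∨ v = c then 1 else (0 : ℕ)) hw
  have S3 := real_partLE_eq_terminalPiece_mul_prod w ({s, a, b, c} : Finset V) part
    (fun v => if v = a then 1 else if v = b ∨ v = c then 2 else (0 : ℕ)) hw
  have S4 := real_partLE_eq_terminalPiece_mul_prod w ({s, a, b, c} : Finset V) part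
    (fun v => if v = b then 1 else (0 : ℕ)) hw
  have S5 := real_partLE_eq_terminalPiece_mul_prod w ({s, a, b, c} : Finset V) part
    (fun v => if v = a then 1 else if v = b then 2 else (0 : ℕ)) hw
  have S6 := real_partLE_eq_terminalPiece_mul_prod w ({s, a, b, c} : Finset V) part
    (fun v => if v = a ∨ v = c then 1 else if v = b then 2 else (0 : ℕ)) hw
  have S7 := real_partLE_eq_terminalPiece_mul_prod w ({s, a, b, c} : Finset V) part
    (fun v => if v = c then 1 else (0 : ℕ)) hw
  rw [partLE_blk0 hd] at S0
  rw [partLE_blk1 hd] at S1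
  rw [partLE_blk2 hd] at S2
  rw [partLE_blk3 hd] at S3
  rw [partLE_blk4 hd] at S4
  rw [partLE_blk5 hd] at S5
  rw [partLE_blk6 hd] at S6
  rw [partLE_blk7 hd] at S7
  rw [← S0, ← S1, ← S2, ← S3, ← S4, ← S5, ← S6, ← S7] at K
  exact (rowLam_iff w lam s a b c).2 K

end Pieces

end Summit.CriticalPhenomena.PercolationContinuityZ3.Theorems.SuperTerminalP3LamPortPieces
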